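import Summits.Ventures.QEC.Census.CSSNormalFormK1
import HarnessLib

/-!
# Sorting the offset vector `s`: a bijection `μ ≃ Fin |μ|` putting the support of `s` first (KERNEL-PLAN item 3a')

For `s : μ → ZMod 2` there is a bijection `e : μ ≃ Fin (Fintype.card μ)` with `s (e.symm j) = 1 ↔ j < wt s`, i.e. `s ∘ e.symm` is the
sorted vector `1^w 0^{m−w}`, `w = hammingNorm s` (`exists_sorting_equiv`). Built from `Equiv.sumCompl` on the support predicate,
`Fintype.equivFinOfCardEq` on both parts and `finSumFinEquiv`. [folklore]
-/

set_option autoImplicit false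

namespace Summit.Ventures.QEC.Census.CSSNormalFormSAT

/-- **Sorting bijection for the support of `s`.** [folklore] -/
theorem exists_sorting_equiv {μ : Type*} [Fintype μ] [DecidableEq μ] (s : μ → ZMod 2) :
    ∃ e : μ ≃ Fin (Fintype.card μ), ∀ j : Fin (Fintype.card μ), s (e.symm j) = 1 ↔ j.val < hammingNorm s := by
  classical
  set w := hammingNorm s with hw
  let p : μ → Prop := fun q => s q ≠ 0
  have hcardT : Fintype.card {q // p q} = w := by
    rw [Fintype.card_subtype, hw, hammingNorm]
  have hcardF : Fintype.card {q // ¬ p q} = Fintype.card μ - w := by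
    rw [Fintype.card_subtype_compl, hcardT]
  have hwle : w ≤ Fintype.card μ := by
    rw [← hcardT]; exact Fintype.card_subtype_le p
  have hsum : w + (Fintype.card μ - w) = Fintype.card μ := by omega
  let e1 : {q // p q} ≃ Fin w := Fintype.equivFinOfCardEq hcardT
  let e2 : {q // ¬ p q} ≃ Fin (Fintype.card μ - w) := Fintype.equivFinOfCardEq hcardF
  let E : μ ≃ Fin (Fintype.card μ) :=
    (Equiv.sumCompl p).symm.trans ((e1.sumCongr e2).trans (finSumFinEquiv.trans (finCongr hsum)))
  refine ⟨E, fun j => ?_⟩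
  -- characterise E on support / non-support elements
  have hval : ∀ q : μ, (p q ↔ (E q).val < w) := by
    intro q
    by_cases hq : p q
    · simp only [E, Equiv.trans_apply, Equiv.sumCompl_symm_apply_of_pos hq, Equiv.sumCongr_apply, Sum.map_inl,
        finSumFinEquiv_apply_left, finCongr_apply, Fin.val_cast, Fin.val_castAdd]
      exact ⟨fun _ => (e1 ⟨q, hq⟩).isLt, fun _ => hq⟩
    · simp only [E, Equiv.trans_apply, Equiv.sumCompl_symm_apply_of_neg hq, Equiv.sumCongr_apply, Sum.map_inr,
        finSumFinEquiv_apply_right, finCongr_apply, Fin.val_cast, Fin.val_natAdd]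
      exact ⟨fun h => absurd h hq, fun h => by omega⟩
  have z2 : ∀ x : ZMod 2, x = 1 ↔ x ≠ 0 := by decide
  rw [z2]
  have := hval (E.symm j)
  rw [Equiv.apply_symm_apply] at this
  exact this

end Summit.Ventures.QEC.Census.CSSNormalFormSAT
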